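import Summits.QuantumFields.YangMills.Theorems.BalabanLadderUVSeamRecWeakWindowThreePoint
import Summits.QuantumFields.YangMills.Theorems.BalabanLadderUVSeamRecWindowFloors
import HarnessLib

/-!
# Crux `UVSeamRec` (stmt-QuantumFields-20043), floors side: scale-window three-point floors from the WEAK clauses (A), (T)

Helper file of the fleet lead prover of crux `NT` (unit `ym-spine-19353-p1`, g2), for the seam's femto discharge path.
VERBATIM re-run of the landed `WindowFloors.windowFloors_threePoint_ratio`
(`Theorems/BalabanLadderUVSeamRecWindowFloorsRatio.lean`, ym-spine-20043-p1) on `threePoint_floor_param_ratio_weak`: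
from `FBL ∧ (A) ∧ (T)` at `a > 0`, `a → 0`, ONE triple of compactly supported pairwise disjoint bumps floors the connected
three-point function at every smearing scale `a β / t`, `t ∈ [κ, 1]` (`windowFloors_threePoint_ratio_weak`).
-/

set_option autoImplicit false

noncomputable section

open scoped SchwartzMap
open MeasureTheory Filter Topology Metric
open Literature.MathematicalPhysics.QuantumFieldTheory Literature.MathematicalPhysics.QuantumLattice
open Literature.MathematicalPhysics.AQFT Literature.Probability.LatticeModels
open Summit.QuantumFields.YangMills.Theorems.OSLegsFromFemtoAndGap.StubLower
open Summit.QuantumFields.YangMills.Cruxes.OSLegsFromFemtoAndGap.DlrCollarTransfer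
open Summit.QuantumFields.YangMills.Cruxes.UVSeamRec.WindowFloors (dist_inv_smul)

namespace Summit.QuantumFields.YangMills.Cruxes.UVSeamRec.WeakWindow

section Window

variable (G : Type) [Group G] [TopologicalSpace G] [IsTopologicalGroup G] [CompactSpace G]
  [MeasurableSpace G] [BorelSpace G] (r : LatticeRep G) (a : ℝ → ℝ)

/-- **Scale-window three-point floors, ratio `κ`, weak clauses**: from `FBL ∧ (A) ∧ (T)` at `a > 0`, `a → 0`, ONE triple of compactly
supported, pairwise disjoint bumps `f, g, h` floors the connected three-point function at EVERY smearing scale `a β / t`,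
`t ∈ [κ, 1]`, uniformly. [folklore] -/
theorem windowFloors_threePoint_ratio_weak {κ : ℝ} (hκ : 0 < κ) (hapos : ∀ β, 0 < a β) (hlim : Tendsto a atTop (𝓝 0))
    (hFBL : FBL G r a)
    (hA : ∃ (β₂ ℓ₂ C₂ : ℝ) (K : ℝ → ℝ) (n₀ : ℕ), 0 < ℓ₂ ∧ (∀ s, 1 ≤ K s) ∧
      Tendsto (fun s : ℝ => s * K s) (nhdsWithin 0 (Set.Ioi 0)) (nhds 0) ∧ 1 ≤ n₀ ∧
      ∀ β : ℝ, β₂ ≤ β → ∀ (x : Fin 4 → ℤ) (R : ℕ), ((2 * R + 1 : ℕ) : ℝ) * a β ≤ ℓ₂ →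
        ∀ (η : LGConfig 4 G) (u u' : Fin 4 → ℤ) (s₀ : ℝ), 0 < s₀ → s₀ ≤ ‖siteToE (u' - u)‖ * a β →
          ‖siteToE (u' - u)‖ * a β ≤ ℓ₂ → (n₀ : ℝ) ≤ ‖siteToE (u' - u)‖ →
            K s₀ * ‖siteToE (u' - u)‖ ≤ depth (fun j => x j - R) (2 * R + 1) u →
            K s₀ * ‖siteToE (u' - u)‖ ≤ depth (fun j => x j - R) (2 * R + 1) u' →
              |‖siteToE (u' - u)‖ ^ 8 *
                  kerCov G r β (fun j => x j - R) (2 * R + 1) η (dens G r u) (dens G r u')| ≤ C₂)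
    (hT : ∃ (v w : EuclideanSpace ℝ (Fin 4)) (σ δ : ℝ) (Γ₃ : ℝ → ℝ) (β₃ ℓ₃ c₃ : ℝ) (K₃ : ℝ → ℝ) (n₃ : ℕ),
      (σ = 1 ∨ σ = -1) ∧ 0 < δ ∧ 2 * δ < ‖v‖ ∧ 2 * δ < ‖w‖ ∧ 2 * δ < ‖v - w‖ ∧ 0 < ℓ₃ ∧ 0 < c₃ ∧
      (∀ s, 1 ≤ K₃ s) ∧ Tendsto (fun s : ℝ => s * K₃ s) (nhdsWithin 0 (Set.Ioi 0)) (nhds 0) ∧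
      Tendsto (fun s : ℝ => Γ₃ s / s ^ 4) (nhdsWithin 0 (Set.Ioi 0)) atTop ∧
      ∀ β : ℝ, β₃ ≤ β → ∀ (x : Fin 4 → ℤ) (R : ℕ), ((2 * R + 1 : ℕ) : ℝ) * a β ≤ ℓ₃ →
        ∀ (η : LGConfig 4 G) (n : ℕ) (y z : Fin 4 → ℤ) (s₀ : ℝ), 0 < s₀ → s₀ ≤ (n : ℝ) * a β →
          n₃ ≤ n → ‖siteToE (y - x) - (n : ℝ) • v‖ ≤ δ * n → ‖siteToE (z - x) - (n : ℝ) • w‖ ≤ δ * n →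
            K₃ s₀ * n ≤ depth (fun j => x j - R) (2 * R + 1) x →
            K₃ s₀ * n ≤ depth (fun j => x j - R) (2 * R + 1) y →
            K₃ s₀ * n ≤ depth (fun j => x j - R) (2 * R + 1) z →
              c₃ * Γ₃ ((n : ℝ) * a β) ≤
                σ * (n : ℝ) ^ 12 * kerK3 G r β (fun j => x j - R) (2 * R + 1) η x y z) :
    ∃ (f g h : 𝓢(EuclideanSpace ℝ (Fin 4), ℝ)) (ε β₅ Λ₅ : ℝ),
      HasCompactSupport (f : EuclideanSpace ℝ (Fin 4) → ℝ) ∧ HasCompactSupport (g : EuclideanSpace ℝ (Fin 4) → ℝ) ∧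
      HasCompactSupport (h : EuclideanSpace ℝ (Fin 4) → ℝ) ∧
      Disjoint (tsupport (f : EuclideanSpace ℝ (Fin 4) → ℝ)) (tsupport (g : EuclideanSpace ℝ (Fin 4) → ℝ)) ∧
      Disjoint (tsupport (g : EuclideanSpace ℝ (Fin 4) → ℝ)) (tsupport (h : EuclideanSpace ℝ (Fin 4) → ℝ)) ∧
      Disjoint (tsupport (f : EuclideanSpace ℝ (Fin 4) → ℝ)) (tsupport (h : EuclideanSpace ℝ (Fin 4) → ℝ)) ∧ 0 < ε ∧
      ∀ t ∈ Set.Icc κ 1, ∀ β : ℝ, β₅ ≤ β → ∀ L : ℕ, Λ₅ ≤ a β * L →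
        ε ≤ |Q3 G r β L (a β / t) f g h| := by
  obtain ⟨v, w, δ, s, ε, β₅, Λ₅, hδ, h2v, h2w, h2vw, hs0, hε, H⟩ :=
    threePoint_floor_param_ratio_weak G r a hκ hapos hlim hFBL hA hT
  -- the master triple of bumps at scale `s`
  have hρ : 0 < δ * s / 8 := by positivity
  obtain ⟨f, hf0, -, hfone, hfsupp, hfts⟩ :=
    exists_bump_schwartz (0 : EuclideanSpace ℝ (Fin 4)) (ρ := δ * s / 8) hρ
  obtain ⟨g, hg0, -, hgone, hgsupp, hgts⟩ := exists_bump_schwartz (s • v) (ρ := δ * s / 8) hρ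
  obtain ⟨h, hh0, -, hhone, hhsupp, hhts⟩ := exists_bump_schwartz (s • w) (ρ := δ * s / 8) hρ
  refine ⟨f, g, h, ε, β₅, Λ₅, ?_, ?_, ?_, ?_, ?_, ?_, hε, fun t ht β hβ L hL => ?_⟩
  · rw [HasCompactSupport, hfts]; exact isCompact_closedBall _ _
  · rw [HasCompactSupport, hgts]; exact isCompact_closedBall _ _
  · rw [HasCompactSupport, hhts]; exact isCompact_closedBall _ _
  · rw [hfts, hgts]
    refine closedBall_disjoint_closedBall ?_
    rw [dist_eq_norm, zero_sub, norm_neg, norm_smul, Real.norm_eq_abs, abs_of_pos hs0]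
    have := mul_lt_mul_of_pos_left (show δ / 2 < ‖v‖ by linarith only [h2v, hδ]) hs0
    linarith only [this]
  · rw [hgts, hhts]
    refine closedBall_disjoint_closedBall ?_
    rw [dist_eq_norm, ← smul_sub, norm_smul, Real.norm_eq_abs, abs_of_pos hs0]
    have := mul_lt_mul_of_pos_left (show δ / 2 < ‖v - w‖ by linarith only [h2vw, hδ]) hs0
    linarith only [this]
  · rw [hfts, hhts]
    refine closedBall_disjoint_closedBall ?_
    rw [dist_eq_norm, zero_sub, norm_neg, norm_smul, Real.norm_eq_abs, abs_of_pos hs0]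
    have := mul_lt_mul_of_pos_left (show δ / 2 < ‖w‖ by linarith only [h2w, hδ]) hs0
    linarith only [this]
  -- dilate the triple by `t⁻¹`: bumps at scale `t·s ∈ [κs, s]`
  obtain ⟨htlo, hthi⟩ := ht
  have ht0 : 0 < t := by linarith
  obtain ⟨Dl, hDl⟩ := UnitDilation.exists_dilation t⁻¹ (inv_ne_zero ht0.ne')
  have hQ : Q3 G r β L (a β / t) f g h =
      Q3 G r β L (a β) (SchwartzMap.compCLMOfContinuousLinearEquiv ℝ Dl f)
        (SchwartzMap.compCLMOfContinuousLinearEquiv ℝ Dl g) (SchwartzMap.compCLMOfContinuousLinearEquiv ℝ Dl h) := by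
    rw [UnitDilation.Q3_compCLM Dl t⁻¹ hDl]
    congr 1
    field_simp
  rw [hQ]
  have hts : t * s ∈ Set.Icc (κ * s) s := ⟨mul_le_mul_of_nonneg_right htlo hs0.le, by nlinarith⟩
  have ht8 : t⁻¹ * (δ * (t * s) / 8) = δ * s / 8 := by field_simp
  -- plateau / support data of a dilated bump
  have hplat : ∀ (q : 𝓢(EuclideanSpace ℝ (Fin 4), ℝ)) (p : EuclideanSpace ℝ (Fin 4)),
      (∀ z, dist z (s • p) ≤ δ * s / 8 → q z = 1) →
      ∀ z, dist z ((t * s) • p) ≤ δ * (t * s) / 8 → SchwartzMap.compCLMOfContinuousLinearEquiv ℝ Dl q z = 1 := by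
    intro q p hq z hz
    rw [SchwartzMap.compCLMOfContinuousLinearEquiv_apply, Function.comp_apply, hDl]
    refine hq _ ?_
    rw [dist_inv_smul t ht0, smul_smul]
    calc t⁻¹ * dist z ((t * s) • p) ≤ t⁻¹ * (δ * (t * s) / 8) := mul_le_mul_of_nonneg_left hz (inv_pos.2 ht0).le
      _ = δ * s / 8 := ht8
  have hsupp : ∀ (q : 𝓢(EuclideanSpace ℝ (Fin 4), ℝ)) (p : EuclideanSpace ℝ (Fin 4)),
      (∀ z, q z ≠ 0 → dist z (s • p) < 2 * (δ * s / 8)) →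
      ∀ z, SchwartzMap.compCLMOfContinuousLinearEquiv ℝ Dl q z ≠ 0 → dist z ((t * s) • p) < 2 * (δ * (t * s) / 8) := by
    intro q p hq z hz
    rw [SchwartzMap.compCLMOfContinuousLinearEquiv_apply, Function.comp_apply, hDl] at hz
    have h1 := hq _ hz
    rw [dist_inv_smul t ht0, smul_smul] at h1
    have h2 : t⁻¹ * dist z ((t * s) • p) < t⁻¹ * (2 * (δ * (t * s) / 8)) := by
      calc t⁻¹ * dist z ((t * s) • p) < 2 * (δ * s / 8) := h1
        _ = t⁻¹ * (2 * (δ * (t * s) / 8)) := by rw [← ht8]; ring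
    exact lt_of_mul_lt_mul_left h2 (inv_pos.2 ht0).le
  have hnn : ∀ (q : 𝓢(EuclideanSpace ℝ (Fin 4), ℝ)), (∀ z, 0 ≤ q z) →
      ∀ z, 0 ≤ SchwartzMap.compCLMOfContinuousLinearEquiv ℝ Dl q z := by
    intro q hq z
    rw [SchwartzMap.compCLMOfContinuousLinearEquiv_apply, Function.comp_apply]
    exact hq _
  -- centre `0 = s • 0 = (t s) • 0`
  have hf1 : ∀ z, dist z (s • (0 : EuclideanSpace ℝ (Fin 4))) ≤ δ * s / 8 → f z = 1 := by
    intro z hz; rw [smul_zero] at hz; exact hfone z hz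
  have hf2 : ∀ z, f z ≠ 0 → dist z (s • (0 : EuclideanSpace ℝ (Fin 4))) < 2 * (δ * s / 8) := by
    intro z hz; rw [smul_zero]; exact hfsupp z hz
  refine H (t * s) hts _ _ _ (hnn f hf0) (fun z hz => hplat f 0 hf1 z (by rwa [smul_zero])) (fun z hz => ?_)
    (hnn g hg0) (hplat g v hgone) (hsupp g v hgsupp) (hnn h hh0) (hplat h w hhone) (hsupp h w hhsupp) β hβ L hL
  have := hsupp f 0 hf2 z hz
  rwa [smul_zero] at this


end Window

end Summit.QuantumFields.YangMills.Cruxes.UVSeamRec.WeakWindow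

end
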